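import Summits.QuantumFields.BalabanUV.T4Continuum.Support.OutputRateInsertion

/-!
# OutputRateInsertionWitness — non-vacuity with `δ′ > 0` for `OutputRateInsertion` (binder row NE5, node U3, wall W4): a toy
# step model with a genuinely η-DEPENDENT history insertion on which every hypothesis shape of the W4-production holds, the
# Cauchy route's constant versus the direct one (cell `pub-balaban`, T⁴ fan-out, owner lineage t4-ne5-p1, gen 25; LEAN
# PLACEMENT RULE 2026-08-19: cell bookkeeping under `Summits/`)

HONEST FRAMING (T4-DAG PAGE 1).  Rung (B)+1 only (finite T⁴; NOT infinite volume, NOT mass gap, NOT Clay); `FlowStep.BetaPertH`,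
(B), (B^μ) untouched and not hidden.  NE5 is NOT PRINTED in [Balaban1987RG1]–[Balaban1989LargeFieldII] and NOT PROVED anywhere
in the tree; spine 0/9 unchanged.  This module is a DECIDED TOY on the lineage's `toyCarriers` (domains = creation steps, no tree
length, trivial backgrounds): nothing of Bałaban is modelled or asserted; 0 cite tags.  HONEST DEPENDENCY (cell, verbatim):
continuum YM on T⁴ ⇐ BetaPertH ∧ nine spine estimates (0/9 proved); BetaPertH ⇐ (D1) ∧ (D4) ∧ CAP+tail; G-an2-4 gates asym, D1
and NE2/3/4.

CONTENT.  Every model of the lineage up to gen 24 inserts η-INDEPENDENTLY (`δ′ = 0`: `toy_insertionRate`, `toyS_insertionRate`,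
`sharp_insertionRate`, `res_insertionRate`, …).  `insToyModel`: operator data `1 + (1/2)^k/4` (run A) versus `1` (run B) with
margin `1/2`, insertions `o · toyIns k t` read at those data — so `insA ≠ insB`.  On it: `toyI_readsIns` (same-data reading
`InsOpModel.ofStep`), `toyI_operatorRate` (W1: `δ = 1/2`, rate `1/2`), `toyI_insOpEnvelope` (W2-ins with `Gi = 9/128`),
`toyI_insBoundA`; the Cauchy route `insertionRate_of_operatorRate_near` PRODUCES `InsertionRate 0 3 (9/128) (1/2)`
(`toyI_insertionRate_cauchy`), the direct computation gives `InsertionRate 0 3 (3/256) (1/2)` (`toyI_insertionRate_direct`):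
the loss is EXACTLY the factor 6 = (1 + rOp)/rOp · 1/(1 − ρ₀) at `rOp = ρ₀ = 1/2` (decided `example`) — CONSTANT-only, the
same phenomenon as the lineage's "exact Λ = 1 vs Cauchy" numbers for W2 (W4's `δ′` enters NE5's constant `Λ(δ + δ′) + B`,
never the exponent nor the smallness S).
-/

noncomputable section

open Set Finset Metric

namespace Summit.QuantumFields.BalabanUV.T4Continuum.OutputRateInsertionWitness

open Literature.MathematicalPhysics.QuantumFieldTheory.Balaban1983to89
open Literature.MathematicalPhysics.QuantumFieldTheory.Balaban1983to89.T4OutputRate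
open Literature.MathematicalPhysics.QuantumFieldTheory.Balaban1983to89.T4InputCauchyRate
open Literature.MathematicalPhysics.QuantumFieldTheory.Balaban1983to89.T4InputCauchyRateData
open Summit.QuantumFields.BalabanUV.T4Continuum.OutputRateInsertion

/-! ## The toy -/

section Toy

/-- On level-3 tables the lineage's toy insertion `toyIns k t` (previous scale, gain 1/64) is bounded by `3/64`. [folklore] -/
theorem norm_toyIns_le {t : toyCarriers.Dom → ℝ} (ht : ∀ Y, |t Y| ≤ 3 * Real.exp (-(0 * toyCarriers.d Y))) (k : ℕ) :
    ‖toyIns k t‖ ≤ 3 / 64 := by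
  unfold toyIns
  split_ifs with hk
  · norm_num
  · have h := ht (k - 1)
    rw [zero_mul, neg_zero, Real.exp_zero, mul_one] at h
    rw [Complex.norm_real, Real.norm_eq_abs, abs_mul, abs_of_pos (by norm_num : (0 : ℝ) < 1 / 64)]
    linarith

/-- TOY STEP MODEL WITH AN η-DEPENDENT INSERTION (`toyCarriers`): operator data `1 + (1/2)^k/4` (run A) versus `1` (run B),
margin `1/2`; insertions `o·toyIns k t` read at those data (`insA ≠ insB`); history margin `1`; output and base class
irrelevant. [folklore] -/
def insToyModel : StepModel toyCarriers ℂ ℂ where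
  Out := fun _ o h _ => o + h
  opA := fun _ _ k => ((1 + 1 / 4 * (1 / 2 : ℝ) ^ k : ℝ) : ℂ)
  opB := fun _ _ _ => 1
  insA := fun _ _ k t => ((1 + 1 / 4 * (1 / 2 : ℝ) ^ k : ℝ) : ℂ) * toyIns k t
  insB := fun _ _ k t => toyIns k t
  Base := fun _ _ _ => Set.univ
  rOp := fun _ => 1 / 2
  rHist := fun _ => 1
  rOp_pos := fun _ => by norm_num
  rHist_pos := fun _ => one_pos

/-- The toy's insertion functional: the operator datum times the toy insertion. [folklore] -/
def toyInsFun : ℕ → ℂ → (toyCarriers.Dom → ℝ) → ℂ := fun k o t => o * toyIns k t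

/-- Toy: both runs' insertions are `toyInsFun` at the run's own operator datum (same-data reading). [folklore] -/
theorem toyI_readsIns : (InsOpModel.ofStep insToyModel toyInsFun).ReadsIns Set.univ := by
  intro k g _ U t
  refine ⟨rfl, ?_⟩
  show toyIns k t = 1 * toyIns k t
  rw [one_mul]

/-- Toy: W1 — operator discrepancy `(1/2)^k/4 = (1/2)·(1/2)^k·rOp`: `δ = 1/2` at rate `1/2`. [folklore] -/
theorem toyI_operatorRate : insToyModel.OperatorRate Set.univ (1 / 2) (1 / 2) := by
  intro k g _ U
  show ‖(((1 + 1 / 4 * (1 / 2 : ℝ) ^ k : ℝ) : ℂ)) - 1‖ ≤ 1 / 2 * (1 / 2) ^ k * (1 / 2)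
  have h : (((1 + 1 / 4 * (1 / 2 : ℝ) ^ k : ℝ) : ℂ)) - 1 = (((1 / 4 * (1 / 2 : ℝ) ^ k : ℝ)) : ℂ) := by
    push_cast; ring
  rw [h, Complex.norm_real, Real.norm_eq_abs, abs_of_nonneg (by positivity)]
  linarith [pow_nonneg (by norm_num : (0 : ℝ) ≤ 1 / 2) k]

/-- Toy: W2-ins — along `1 + ζu`, `|ζ| ≤ 1`, `‖u‖ ≤ 1/2`, the insertion of a level-3 table is entire and bounded by
`(3/2)(3/64) = 9/128`. [folklore] -/
theorem toyI_insOpEnvelope : (InsOpModel.ofStep insToyModel toyInsFun).InsOpEnvelope Set.univ 0 3 (9 / 128) := by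
  intro k g _ U t ht u hu
  change ‖u‖ ≤ 1 / 2 at hu
  refine ⟨?_, ?_⟩
  · show DifferentiableOn ℂ (fun ζ : ℂ => (1 + ζ • u) * toyIns k t) (closedBall 0 1)
    exact ((differentiable_const _).add (differentiable_id.smul_const u)).mul_const _ |>.differentiableOn
  · intro ζ hζ
    rw [mem_closedBall, dist_zero_right] at hζ
    show ‖(1 + ζ • u) * toyIns k t‖ ≤ 9 / 128 * 1
    have h1 : ‖1 + ζ • u‖ ≤ 3 / 2 :=
      calc ‖1 + ζ • u‖ ≤ ‖(1 : ℂ)‖ + ‖ζ • u‖ := norm_add_le _ _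
        _ = 1 + ‖ζ‖ * ‖u‖ := by rw [norm_one, norm_smul]
        _ ≤ 1 + 1 * (1 / 2) := by gcongr
        _ = 3 / 2 := by norm_num
    rw [norm_mul]
    calc ‖1 + ζ • u‖ * ‖toyIns k t‖ ≤ 3 / 2 * (3 / 64) := mul_le_mul h1 (norm_toyIns_le ht k) (norm_nonneg _) (by norm_num)
      _ = 9 / 128 * 1 := by norm_num

/-- Toy: run A's one-run insertion bound `(1 + (1/2)^k/4)(3/64) ≤ (5/4)(3/64) ≤ 9/128`. [folklore] -/
theorem toyI_insBoundA : (InsOpModel.ofStep insToyModel toyInsFun).InsBoundA Set.univ 0 3 (9 / 128) := by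
  intro k g _ U t ht
  show ‖(((1 + 1 / 4 * (1 / 2 : ℝ) ^ k : ℝ) : ℂ)) * toyIns k t‖ ≤ 9 / 128 * 1
  have hp : (1 / 2 : ℝ) ^ k ≤ 1 := pow_le_one₀ (by norm_num) (by norm_num)
  have h1 : ‖(((1 + 1 / 4 * (1 / 2 : ℝ) ^ k : ℝ) : ℂ))‖ ≤ 5 / 4 := by
    rw [Complex.norm_real, Real.norm_eq_abs, abs_of_nonneg (by positivity)]
    linarith
  rw [norm_mul]
  calc ‖(((1 + 1 / 4 * (1 / 2 : ℝ) ^ k : ℝ) : ℂ))‖ * ‖toyIns k t‖ ≤ 5 / 4 * (3 / 64) :=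
        mul_le_mul h1 (norm_toyIns_le ht k) (norm_nonneg _) (by norm_num)
    _ ≤ 9 / 128 * 1 := by norm_num

/-- Toy, CAUCHY ROUTE: reach `(1/2)(1/2)^k ≤ 1/2 = ρ₀` at every scale, so §3 gives W4 with
`δ′ = (9/128)(1/2)/(1 − 1/2) = 9/128` at rate `1/2`. [folklore] -/
theorem toyI_insertionRate_cauchy : insToyModel.InsertionRate Set.univ 0 3 (9 / 128) (1 / 2) := by
  have h := insertionRate_of_operatorRate_near insToyModel toyInsFun (ρ₀ := 1 / 2) toyI_readsIns toyI_insOpEnvelope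
    toyI_operatorRate (by norm_num)
    (fun k => by
      have hp : (1 / 2 : ℝ) ^ k ≤ 1 := pow_le_one₀ (by norm_num) (by norm_num)
      linarith)
  norm_num at h
  exact h

/-- Toy, DIRECT: `‖insA − insB‖ = ((1/2)^k/4)·|toyIns k t| ≤ (3/256)(1/2)^k` — the true constant is `δ′ = 3/256`. [folklore] -/
theorem toyI_insertionRate_direct : insToyModel.InsertionRate Set.univ 0 3 (3 / 256) (1 / 2) := by
  intro k g _ U t ht
  show ‖(((1 + 1 / 4 * (1 / 2 : ℝ) ^ k : ℝ) : ℂ)) * toyIns k t - toyIns k t‖ ≤ 3 / 256 * (1 / 2) ^ k * 1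
  have h : (((1 + 1 / 4 * (1 / 2 : ℝ) ^ k : ℝ) : ℂ)) * toyIns k t - toyIns k t =
      (((1 / 4 * (1 / 2 : ℝ) ^ k : ℝ)) : ℂ) * toyIns k t := by
    push_cast; ring
  rw [h, norm_mul, Complex.norm_real, Real.norm_eq_abs, abs_of_nonneg (by positivity)]
  calc 1 / 4 * (1 / 2 : ℝ) ^ k * ‖toyIns k t‖ ≤ 1 / 4 * (1 / 2 : ℝ) ^ k * (3 / 64) :=
        mul_le_mul_of_nonneg_left (norm_toyIns_le ht k) (by positivity)
    _ = 3 / 256 * (1 / 2) ^ k * 1 := by ring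

/-- The Cauchy route's loss on the toy is EXACTLY the factor 6 = `(1 + rOp)/rOp · 1/(1 − ρ₀)` at `rOp = ρ₀ = 1/2` —
constant-only, as for W2's "exact Λ = 1 vs Cauchy" numbers of the lineage. [folklore] -/
example : (9 / 128 : ℝ) / (3 / 256) = 6 ∧ ((1 + 1 / 2) / (1 / 2) * (1 / (1 - 1 / 2)) : ℝ) = 6 := by norm_num

end Toy

end Summit.QuantumFields.BalabanUV.T4Continuum.OutputRateInsertionWitness

end
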